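import Literature.Analysis.Complex.HolomorphicParametricIntegral
import Literature.MathematicalPhysics.QuantumFieldTheory.Balaban1983to89.T4HistoryLipschitzActivity
import Summits.QuantumFields.BalabanUV.T4Continuum.Spine.NE1p.DressedSmallFieldPencil

/-!
# T⁴ programme, spine estimate NE1′ (node O3b/H2) — THE (2.14)-SHAPE OF A DRESSED ACTIVITY READ ALONG THE DRESSED
# POTENTIAL TABLE: per-polymer analyticity in the source (E1), the source-free (2.15)-majorant (E2) — the «ε₁ ↦ ε₁ + (attached
# size)» substitution TYPED — and the μ-part of the dressed small-field output from these data (feeding `DressedSmallFieldPencil`)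

Cell `pub-balaban`, sub-cell `t4`, BINDER-OWNERS row NE1′; owner lineage t4-ne1p-p1 (PROVER seat P1, «RG-trajectory comparison …
term by term with the observable insertion, tracking μ-uniformity through the printed small-field bounds»), generation 26;
ADDITIVE — imports `Literature/Analysis/Complex/HolomorphicParametricIntegral` (dominated holomorphic parameter integrals with NO
derivative hypothesis), `Literature/…/Balaban1983to89/T4HistoryLipschitzActivity` (node U3 ∕ NE9-P2's averaged exp-linear
activities, §6–§7 there) and `Spine/NE1p/DressedSmallFieldPencil` (N0j, this generation) ONLY; THEOREMS ONLY (+ two `example`s).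

WHY THIS FILE.  `DressedSmallFieldPencil` takes, per polymer, (E1) «`s ↦ act s Z` complex differentiable on the source disc» and
(E2) «`‖act s Z‖ ≤ m Z`, `m` source-free».  Print locates where the potential table enters an activity — [Balaban1988RGII] (2.14)
p. 15: a term of `H(Z)` is a Gaussian ∕ parameter average of «(table-free factor) × exp[Σ_{Y∈𝐃} τ(Y)𝐕_k(Y,B)]», p. 15 «We
consider it as an analytic function of (𝐔,𝐉) in the space 𝐔^c_{k+1}(X,α₀,α₁), and of the complex parameters σ(Z), τ.»,
bounded in (2.15) by the same expression with «exp[Σ_{Y∈𝐃}|τ(Y)||𝐕_k(Y,B)|]»; the radius of the τ(Y)-circle is the INVERSE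
SIZE of the table entry, p. 16 «We take a small, positive number α₄, to be chosen later, and 1/|τ(Y)| = E₀ε₁C₁α₄⁻¹M^q exp C₂κ₁
exp(−(1 − 3δ)κd_k(Y)). (2.18)», and the exponent is then bounded by a quadratic form in the fluctuation field plus a constant,
p. 16 «… ≤ ½O(1)α₄ Σ_{b⊂Y₀}|B(b)|² + O(1)α₄M⁻⁴|Y₀|. (2.20)», absorbed into the Gaussian measure ((2.21)–(2.26)).  Where the OLD
TERMS enter the table — p. 9 Lemma 1: «𝐄_k(U_k(exp iB′V^{(k)})) − 𝐄_k(U_k(V^{(k)})) = Σ_{Y∈𝐃_k} 𝐕′_k(Y, U_{k+1}, B). (1.33)»,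
LINEAR in the old-term functional 𝐄_k, with «|𝐕′_k(Y,𝐔,𝐉,B)| ≤ E₀ε₁C₁M^q exp C₂κ₁ exp(−(1 − 2δ)κd_k(Y)). (1.36)» ∝ the old
terms' uniform size `E₀` of [Balaban1987RGI] (1.18); p. 11 Lemma 2 (1.41)–(1.43): the full table `𝐕_k(Y,B) = ½⟨Q(Y,B),B,B⟩ +
𝐕″_k(Y,B)`, `Q` from the main action, `𝐕″_k` under (1.36).  THE OWNER'S READING (H2 dictionary of record, T4-DAG O3b; a
READING to be graded, not a fact): in the dressed run the observable-attached D-terms 𝐃_k(μ) — analytic in the source `μ` ((w1)),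
of uniform size `D₀` on the source disc `‖μ‖ < μ₁` (L-B ∕ (w6)) — enter ONLY through Lemma 1's linear map, so the DRESSED TABLE
is the curve `μ ↦ 𝐕_k(μ) = 𝐕_k + 𝐕′_k[𝐃_k(μ)]` in a normed space `Pot` of tables, analytic, inside the ball whose radius is
(1.36)'s bound at `E₀ + D₀` in place of `E₀` — the wall's «ε₁ ↦ ε₁ + μ₁b»; everything else in (2.14) (Gaussian measures,
characteristic functions, Γ_k, the s∕t∕σ∕τ parameter integrals, the radii (2.18) FIXED from the dressed size) is μ-FREE.
Abstractly (node U3's `T4HistoryLipschitzActivity` §6–§7 model, here with an ω-DEPENDENT functional bound to be faithful to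
(2.20)): a term is `s ↦ ∫ pre(ω)·exp(ℓ_ω(V s)) dν(ω)` over a parameter space (ω = fluctuation field + interpolation ∕ contour
parameters; `pre` μ-free, a.e.-strongly measurable; `ℓ_ω` μ-free continuous linear functionals on `Pot`, scalarly measurable,
`‖ℓ_ω‖ ≤ l(ω)` with `‖pre(ω)‖·e^{l(ω)R₀}` ν-integrable — the Gaussian absorbing (2.20)); `V` = the dressed table curve.

WHAT IS PROVED ([folklore] kernel; no estimate on Bałaban's functions):
* §1 `differentiableOn_term_comp` — (E1) for one term along a table curve complex differentiable on an open `D ⊆ ℂ` with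
  values in the ball `‖Q‖ < R₀`: dominated holomorphic differentiation under the integral sign with NO derivative hypothesis
  (`Literature.Analysis.Complex.differentiableOn_integral_of_dominated` BY NAME; pointwise majorant
  `T4HistoryLipschitzActivity.norm_const_mul_cexp_le_of_le` BY NAME); `norm_term_comp_le` — (E2): `‖term(s)‖ ≤ ∫‖pre‖e^{l R₀}dν`,
  SOURCE-FREE (it reads the table only through `R₀`).
* §2 `differentiableOn_act_of_rep` ∕ `norm_act_le_of_rep` — the same for an activity REPRESENTED (`hrep`, a displayed binder =
  the (2.14)-shape with μ-free data) as a finite sum over a term index («the sum over 𝐃, P») of such terms.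
* §3 `mapsTo_dressedTable(_smul)`, `differentiableOn_dressedTable`, `differentiable_dressedTable_smul` — the dressed radius:
  undressed table `‖V₀‖ ≤ ε₁`, attached part `< w` on `D` ⇒ the curve lies in the ball of radius `ε₁ + w`; the first dressed
  step `V₀ + s•O` (`‖O‖ ≤ b`) is entire with radius `ε₁ + μ₁b` on `‖s‖ < μ₁`.
* §4 `muPart_locE_le_of_rep` — THE μ-PART OF THE DRESSED SMALL-FIELD OUTPUT FROM THE (2.14)-SHAPE: `‖E_μ(X) − E_0(X)‖ ≤
  (e ν c₁ K₀² · A · e^{−r₁ d(X)}) · μ₀/(μ₁ − μ₀)` from `hrep` + the table's analyticity ∕ radius + ONE Lemma-3 inequality on the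
  μ-FREE prefactor data at the dressed radius (`hL3 : Σ_{j ∈ terms Z} ∫‖pre_j‖e^{l_j R₀}dν_j ≤ A·e^{−R d(Z)}`) + B13's geometry
  ∕ clauses (`DressedSmallFieldPencil.muPart_locE_le` BY NAME); `muPart_locE_le_of_linearDressing` — the first dressed step,
  radius LITERALLY `ε₁ + μ₁b`.
* §5 NON-VACUITY of the analytic data on a decided one-term toy (Dirac parameter measure, identity functional on `Pot = ℂ`,
  linear dressing): §1's two theorems FIRE on it; the B13 geometry binders are the tree's shapes and are not witnessed here.

WHAT REMAINS DISPLAYED after this file + `DressedSmallFieldPencil`, for the small-field half of PAY and for (w5)'s constant: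
(B1) `hrep` — the (2.14)-shape of the dressed activities with μ-FREE term data [the READING above; printed TYPE (2.14) p. 15
for 𝐕_k];  (B2) `hV`∕`hVR` — the dressed table analytic in the source on `‖s‖ < μ₁` with values in the dressed ball [(w1)
births through Lemma 1's linear map + (1.36) TYPE at `E₀ + D₀`; (w6) window];  (B3) `hL3` — Lemma 3 (2.38) for the μ-free
majorants at the dressed radius [printed TYPE (2.15)–(2.38) for 𝐕_k; the cell's re-run = node U3's POTENTIAL-KP uniformity
(GAPS G-ne9p2-5) — ONE binder for rows NE9 and NE1′];  (B4) B13 geometry (tree shapes `Ineq126`∕`VolBound`∕`Ineq227`,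
`hloc`∕`hreach`);  (B5) the clauses at the dressed constant (arithmetic).  The wall's phrase «UNPRINTED μ∕strength-extension of
B13's activity bounds» is hereby LOCALISED to (B3) given the reading (B1): a uniformity-over-tables statement of printed TYPE,
shared with row NE9 — not a new kind of estimate.  NE1′ NOT printed, NOT proved; 0 leaves instantiated; spine PROVED 0∕9;
count 9 unchanged.

HONEST FRAMING.  Rung (B)+1 on ONE finite four-torus — NOT infinite volume, NOT a mass gap, NOT OS on ℝ⁴, NOT Clay.  ABSOLUTE
RULE honoured: the quotations above are LOCI of the audited manuscript [Balaban1988RGII] (CMP 116 (1988) 1–22; renders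
`b2b-balaban-ref1/pages/1988-cmp116-rg-II-cluster/…-p009, p010, p011, p016-x2.png` read as images by this seat this generation,
p015 in generation 25), TYPE∕CONTEXT only, never hypothesis-free facts; nothing internally minted is cited; [folklore] tags on
kernel lemmas only.  HONEST DEPENDENCY: continuum YM on T⁴ ⇐ BetaPertH ∧ nine spine estimates (0/9 proved); BetaPertH ⇐
(D1) ∧ (D4) ∧ CAP+tail; G-an2-4 gates asym, D1 and NE2/3/4.
-/

noncomputable section

namespace Summit.QuantumFields.BalabanUV.T4Continuum.NE1p.DressedSmallFieldShape

open MeasureTheory Metric Set Complex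
open scoped BigOperators
open Literature.MathematicalPhysics.QuantumFieldTheory.Balaban1983to89.T4HistoryLipschitzActivity
  (norm_const_mul_cexp_le_of_le)
open Literature.MathematicalPhysics.QuantumFieldTheory.Balaban1983to89.B13FamilySum (Ineq126 VolBound Ineq227)
open Literature.MathematicalPhysics.QuantumFieldTheory.Balaban1983to89.B13Resummation (locE)
open Summit.QuantumFields.BalabanUV.T4Continuum.NE1p.DressedSmallFieldPencil (muPart_locE_le)

variable {Pot : Type*} [NormedAddCommGroup Pot] [NormedSpace ℂ Pot]
variable {Ω : Type*} [MeasurableSpace Ω]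

/-! ## §1 ONE TERM of the (2.14)-shape read ALONG AN ANALYTIC TABLE CURVE -/

section Term

variable {ν : Measure Ω} {pre : Ω → ℂ} {lin : Ω → (Pot →L[ℂ] ℂ)} {l : Ω → ℝ} {R₀ : ℝ} {V : ℂ → Pot} {D : Set ℂ}

/-- **(E1) FOR ONE TERM ALONG A TABLE CURVE** [folklore]: an averaged exp-linear activity `Q ↦ ∫ pre(ω)·exp(ℓ_ω Q) dν(ω)`
(a.e.-strongly measurable prefactor, scalarly measurable functionals with `‖ℓ_ω‖ ≤ l(ω)` and `‖pre(ω)‖·e^{l(ω)R₀}` integrable —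
(2.20)'s quadratic growth in the fluctuation field absorbed by the Gaussian) read along a table curve `s ↦ V s` that is complex
differentiable on an open set `D` and maps it into the ball `‖Q‖ < R₀` is complex differentiable on `D` — dominated holomorphic
differentiation under the integral sign with NO derivative hypothesis (`Literature.Analysis.Complex.differentiableOn_integral_of_
dominated` BY NAME; pointwise majorant `‖pre(ω)‖·e^{l(ω)R₀}` by `T4HistoryLipschitzActivity.norm_const_mul_cexp_le_of_le`). -/
theorem differentiableOn_term_comp (hpre : AEStronglyMeasurable pre ν)
    (hlinw : ∀ Q : Pot, AEStronglyMeasurable (fun ω => lin ω Q) ν) (hl : ∀ ω, ‖lin ω‖ ≤ l ω)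
    (hint : Integrable (fun ω => ‖pre ω‖ * Real.exp (l ω * R₀)) ν) (hD : IsOpen D)
    (hV : DifferentiableOn ℂ V D) (hVR : MapsTo V D (ball (0 : Pot) R₀)) :
    DifferentiableOn ℂ (fun s => ∫ ω, pre ω * cexp (lin ω (V s)) ∂ν) D := by
  by_cases hDne : D.Nonempty
  swap
  · rw [Set.not_nonempty_iff_eq_empty.1 hDne]; exact differentiableOn_empty
  obtain ⟨s₀, hs₀⟩ := hDne
  have hR0 : 0 ≤ R₀ := (norm_nonneg _).trans (mem_ball_zero_iff.1 (hVR hs₀)).le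
  refine Literature.Analysis.Complex.differentiableOn_integral_of_dominated
    (F := fun s ω => pre ω * cexp (lin ω (V s))) ?_ ?_ ?_
  · intro s _
    exact hpre.mul (Complex.continuous_exp.comp_aestronglyMeasurable (hlinw (V s)))
  · refine Filter.Eventually.of_forall fun ω => ?_
    exact (((lin ω).differentiable.comp_differentiableOn hV).cexp).const_mul (pre ω)
  · intro x₀ hx₀
    obtain ⟨R, hR, hRD⟩ := Metric.isOpen_iff.1 hD x₀ hx₀
    refine ⟨R, hR, hRD, fun ω => ‖pre ω‖ * Real.exp (l ω * R₀), hint, ?_⟩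
    exact Filter.Eventually.of_forall fun ω s hs => norm_const_mul_cexp_le_of_le (hl ω) hR0 (hVR (hRD hs))

/-- **(E2) FOR ONE TERM ALONG A TABLE CURVE** [folklore]: at every point of `D` the term is bounded by the SOURCE-FREE
majorant `∫ ‖pre(ω)‖·e^{l(ω)R₀} dν(ω)` — the abstract (2.14) → (2.15) step at the table `V s`, whose only datum about the table is
the RADIUS `R₀` of the ball containing the curve. -/
theorem norm_term_comp_le (hl : ∀ ω, ‖lin ω‖ ≤ l ω) (hint : Integrable (fun ω => ‖pre ω‖ * Real.exp (l ω * R₀)) ν)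
    (hVR : MapsTo V D (ball (0 : Pot) R₀)) {s : ℂ} (hs : s ∈ D) :
    ‖∫ ω, pre ω * cexp (lin ω (V s)) ∂ν‖ ≤ ∫ ω, ‖pre ω‖ * Real.exp (l ω * R₀) ∂ν := by
  have hR0 : 0 ≤ R₀ := (norm_nonneg _).trans (mem_ball_zero_iff.1 (hVR hs)).le
  exact norm_integral_le_of_norm_le hint
    (Filter.Eventually.of_forall fun ω => norm_const_mul_cexp_le_of_le (hl ω) hR0 (hVR hs))

end Term

/-! ## §2 THE DRESSED ACTIVITY of a polymer = a finite sum of (2.14)-shape terms along the table curve -/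

section Activity

variable {Dom J : Type*} {ν : J → Measure Ω} {pre : J → Ω → ℂ} {lin : J → Ω → (Pot →L[ℂ] ℂ)} {l : J → Ω → ℝ}
  {R₀ : ℝ} {V : ℂ → Pot} {D : Set ℂ} {terms : Dom → Finset J} {act : ℂ → Dom → ℂ}

/-- **(E1) FOR A DRESSED ACTIVITY** [folklore]: an activity REPRESENTED on `D` as a finite sum (over the term index `terms Z`
— print's «sum over 𝐃, P» of (2.14)) of averaged exp-linear terms read along a table curve `V` (complex differentiable on the
open set `D`, valued in the ball `‖Q‖ < R₀`) is complex differentiable on `D`, polymer by polymer. -/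
theorem differentiableOn_act_of_rep
    (hrep : ∀ s ∈ D, ∀ Z, act s Z = ∑ j ∈ terms Z, ∫ ω, pre j ω * cexp (lin j ω (V s)) ∂(ν j))
    (hpre : ∀ j, AEStronglyMeasurable (pre j) (ν j))
    (hlinw : ∀ j (Q : Pot), AEStronglyMeasurable (fun ω => lin j ω Q) (ν j)) (hl : ∀ j ω, ‖lin j ω‖ ≤ l j ω)
    (hint : ∀ j, Integrable (fun ω => ‖pre j ω‖ * Real.exp (l j ω * R₀)) (ν j)) (hD : IsOpen D)
    (hV : DifferentiableOn ℂ V D) (hVR : MapsTo V D (ball (0 : Pot) R₀)) (Z : Dom) :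
    DifferentiableOn ℂ (fun s => act s Z) D := by
  have h : DifferentiableOn ℂ (fun s => ∑ j ∈ terms Z, ∫ ω, pre j ω * cexp (lin j ω (V s)) ∂(ν j)) D :=
    DifferentiableOn.fun_sum fun j _ => differentiableOn_term_comp (hpre j) (hlinw j) (hl j) (hint j) hD hV hVR
  exact h.congr fun s hs => hrep s hs Z

/-- **(E2) FOR A DRESSED ACTIVITY** [folklore]: on `D` the represented activity is bounded by the PARAMETER-FREE majorant
`Σ_{j ∈ terms Z} ∫ ‖pre_j(ω)‖·e^{l_j(ω) R₀} dν_j(ω)` — it reads the table only through the radius `R₀`. -/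
theorem norm_act_le_of_rep
    (hrep : ∀ s ∈ D, ∀ Z, act s Z = ∑ j ∈ terms Z, ∫ ω, pre j ω * cexp (lin j ω (V s)) ∂(ν j))
    (hl : ∀ j ω, ‖lin j ω‖ ≤ l j ω) (hint : ∀ j, Integrable (fun ω => ‖pre j ω‖ * Real.exp (l j ω * R₀)) (ν j))
    (hVR : MapsTo V D (ball (0 : Pot) R₀)) {s : ℂ} (hs : s ∈ D) (Z : Dom) :
    ‖act s Z‖ ≤ ∑ j ∈ terms Z, ∫ ω, ‖pre j ω‖ * Real.exp (l j ω * R₀) ∂(ν j) := by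
  rw [hrep s hs Z]
  exact (norm_sum_le _ _).trans (Finset.sum_le_sum fun j _ => norm_term_comp_le (hl j) (hint j) hVR hs)

end Activity

/-! ## §3 THE DRESSED RADIUS: `ε₁ ↦ ε₁ + (size of the attached part)` -/

section Radius

omit [NormedSpace ℂ Pot] in
/-- **THE DRESSED TABLE STAYS IN THE DRESSED BALL** [folklore]: an undressed table of size `≤ ε₁` plus an attached part of
size `< w` on `D` maps `D` into the ball of radius `ε₁ + w` — the substitution «`ε₁ ↦ ε₁ + μ₁b`» of the wall's small-field
half, as the only datum the majorant of §2 reads. -/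
theorem mapsTo_dressedTable {V₀ : Pot} {W : ℂ → Pot} {ε₁ w : ℝ} {D : Set ℂ} (h0 : ‖V₀‖ ≤ ε₁)
    (hW : ∀ s ∈ D, ‖W s‖ < w) : MapsTo (fun s => V₀ + W s) D (ball (0 : Pot) (ε₁ + w)) := by
  intro s hs
  rw [mem_ball_zero_iff]
  exact (norm_add_le _ _).trans_lt (add_lt_add_of_le_of_lt h0 (hW s hs))

/-- The dressed table is complex differentiable when its attached part is. [folklore] -/
theorem differentiableOn_dressedTable {V₀ : Pot} {W : ℂ → Pot} {D : Set ℂ} (hW : DifferentiableOn ℂ W D) :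
    DifferentiableOn ℂ (fun s => V₀ + W s) D :=
  (differentiableOn_const V₀).add hW

/-- **THE FIRST-STEP DRESSING IS LINEAR IN THE SOURCE** [folklore]: for the observable's table `O` with `‖O‖ ≤ b`, `0 < b`,
the linearly dressed table `s ↦ V₀ + s • O` maps the source disc `‖s‖ < μ₁` into the ball of radius `ε₁ + μ₁ b`. -/
theorem mapsTo_dressedTable_smul {V₀ O : Pot} {ε₁ μ₁ b : ℝ} (h0 : ‖V₀‖ ≤ ε₁) (hO : ‖O‖ ≤ b) (hb : 0 < b) :
    MapsTo (fun s : ℂ => V₀ + s • O) (ball (0 : ℂ) μ₁) (ball (0 : Pot) (ε₁ + μ₁ * b)) := by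
  refine mapsTo_dressedTable h0 fun s hs => ?_
  rw [mem_ball_zero_iff] at hs
  rw [norm_smul]
  calc ‖s‖ * ‖O‖ ≤ ‖s‖ * b := mul_le_mul_of_nonneg_left hO (norm_nonneg _)
    _ < μ₁ * b := mul_lt_mul_of_pos_right hs hb

/-- The linearly dressed table is entire in the source. [folklore] -/
theorem differentiable_dressedTable_smul (V₀ O : Pot) : Differentiable ℂ (fun s : ℂ => V₀ + s • O) :=
  (differentiable_const V₀).add (differentiable_id.smul_const O)

end Radius

/-! ## §4 THE END FROM THE (2.14)-SHAPE: the μ-part of the dressed small-field output read along the dressed table -/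

section EndOfShape

variable {Dom Cube J : Type*} [DecidableEq Dom] [DecidableEq Cube] [Fintype Dom]
variable (ι : Dom → Dom → Prop) [DecidableRel ι]

/-- **THE μ-PART OF THE DRESSED SMALL-FIELD OUTPUT FROM THE (2.14)-SHAPE** (kernel; §2 + §4): the dressed activities
REPRESENTED on the source disc `‖s‖ < μ₁` as finite sums of averaged exp-linear terms read along a dressed table curve `V`
(complex differentiable on the disc, valued in the dressed ball `‖Q‖ < R₀` — (w1) births analytic in the source + (w6) the
source window, BY NAME as `hV`∕`hVR`), print's Lemma 3 chain (2.15) → (2.38) as ONE inequality on the SOURCE-FREE prefactor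
data at the dressed radius (`hL3` : `Σ_{j ∈ terms Z} (∫‖pre_j‖dν_j)·e^{l_j R₀} ≤ A·e^{−R d(Z)}` — the «ε₁ ↦ ε₁ + μ₁b» re-run,
a BINDER), and B13's geometry ∕ clauses give, for `0 < μ₀ < μ₁`, `‖μ‖ ≤ μ₀`:
`‖E_μ(X) − E_0(X)‖ ≤ (e ν c₁ K₀² · A · e^{−r₁ d(X)}) · μ₀/(μ₁ − μ₀)`. -/
theorem muPart_locE_le_of_rep [Std.Refl ι] [Std.Symm ι] {cubes reach : Dom → Finset Cube} {d : Dom → ℝ}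
    {ν' : J → Measure Ω} {pre : J → Ω → ℂ} {lin : J → Ω → (Pot →L[ℂ] ℂ)} {l : J → Ω → ℝ} {R₀ : ℝ} {V : ℂ → Pot}
    {terms : Dom → Finset J} {act : ℂ → Dom → ℂ} {A R r₁ κ₀ K₀ c₁ c b ν dX μ₁ μ₀ : ℝ} {X : Finset Cube} {μ : ℂ}
    (hloc : ∀ Z Z', ι Z' Z → ∃ q ∈ reach Z, q ∈ cubes Z')
    (hreach : ∀ Z, ((reach Z).card : ℝ) ≤ ν * (cubes Z).card)
    (hd : ∀ Z, 0 ≤ d Z) (hA : 0 ≤ A) (hK₀ : 0 ≤ K₀) (hc₁ : 0 ≤ c₁) (hν : 0 ≤ ν) (hκ₀ : 0 ≤ κ₀)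
    (hr₁ : 0 ≤ r₁) (hc : 0 ≤ c) (hb : r₁ * c ≤ b)
    (h126 : Ineq126 (Finset.univ : Finset Dom) cubes d κ₀ K₀)
    (hvol : VolBound (Finset.univ : Finset Dom) cubes d c₁)
    (h227 : Ineq227 (Finset.univ : Finset Dom) cubes d X dX c)
    (hrate : r₁ + 2 * κ₀ + 2 ≤ R) (hsmall : A * Real.exp (b + 1) * K₀ * ν * c₁ ≤ 1) (hX : X.Nonempty)
    (hrep : ∀ s ∈ ball (0 : ℂ) μ₁, ∀ Z, act s Z = ∑ j ∈ terms Z, ∫ ω, pre j ω * cexp (lin j ω (V s)) ∂(ν' j))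
    (hpre : ∀ j, AEStronglyMeasurable (pre j) (ν' j))
    (hlinw : ∀ j (Q : Pot), AEStronglyMeasurable (fun ω => lin j ω Q) (ν' j)) (hl : ∀ j ω, ‖lin j ω‖ ≤ l j ω)
    (hint : ∀ j, Integrable (fun ω => ‖pre j ω‖ * Real.exp (l j ω * R₀)) (ν' j))
    (hV : DifferentiableOn ℂ V (ball (0 : ℂ) μ₁)) (hVR : MapsTo V (ball (0 : ℂ) μ₁) (ball (0 : Pot) R₀))
    (hL3 : ∀ Z, cubes Z ⊆ X →
      ∑ j ∈ terms Z, ∫ ω, ‖pre j ω‖ * Real.exp (l j ω * R₀) ∂(ν' j) ≤ A * Real.exp (-(R * d Z)))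
    (h0 : 0 < μ₀) (h01 : μ₀ < μ₁) (hμ : ‖μ‖ ≤ μ₀) :
    ‖locE ι cubes (act μ) X - locE ι cubes (act 0) X‖ ≤
      Real.exp 1 * ν * c₁ * K₀ ^ 2 * A * Real.exp (-(r₁ * dX)) * (μ₀ / (μ₁ - μ₀)) :=
  muPart_locE_le ι (m := fun Z => ∑ j ∈ terms Z, ∫ ω, ‖pre j ω‖ * Real.exp (l j ω * R₀) ∂(ν' j)) hloc hreach hd hA
    hK₀ hc₁ hν hκ₀ hr₁ hc hb h126 hvol h227 hrate hsmall hX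
    (fun Z _ => differentiableOn_act_of_rep hrep hpre hlinw hl hint isOpen_ball hV hVR Z)
    (fun _ hs Z _ => norm_act_le_of_rep hrep hl hint hVR hs Z) hL3 h0 h01 hμ

/-- **THE FIRST DRESSED STEP** (kernel; §3 + `muPart_locE_le_of_rep`): at the step where the observable enters, the dressed table
is LINEAR in the source, `V s = V₀ + s • O` with `‖V₀‖ ≤ ε₁` (print's potential smallness) and `‖O‖ ≤ b`, `0 < b` (the
observable's table); the dressed radius is then LITERALLY `ε₁ + μ₁ b`, and the μ-part bound holds with print's Lemma 3 chain
re-run at that radius (`hL3`). -/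
theorem muPart_locE_le_of_linearDressing [Std.Refl ι] [Std.Symm ι] {cubes reach : Dom → Finset Cube} {d : Dom → ℝ}
    {ν' : J → Measure Ω} {pre : J → Ω → ℂ} {lin : J → Ω → (Pot →L[ℂ] ℂ)} {l : J → Ω → ℝ} {V₀ O : Pot}
    {terms : Dom → Finset J} {act : ℂ → Dom → ℂ} {A R r₁ κ₀ K₀ c₁ c b ν dX μ₁ μ₀ ε₁ b₀ : ℝ} {X : Finset Cube}
    {μ : ℂ}
    (hloc : ∀ Z Z', ι Z' Z → ∃ q ∈ reach Z, q ∈ cubes Z')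
    (hreach : ∀ Z, ((reach Z).card : ℝ) ≤ ν * (cubes Z).card)
    (hd : ∀ Z, 0 ≤ d Z) (hA : 0 ≤ A) (hK₀ : 0 ≤ K₀) (hc₁ : 0 ≤ c₁) (hν : 0 ≤ ν) (hκ₀ : 0 ≤ κ₀)
    (hr₁ : 0 ≤ r₁) (hc : 0 ≤ c) (hb : r₁ * c ≤ b)
    (h126 : Ineq126 (Finset.univ : Finset Dom) cubes d κ₀ K₀)
    (hvol : VolBound (Finset.univ : Finset Dom) cubes d c₁)
    (h227 : Ineq227 (Finset.univ : Finset Dom) cubes d X dX c)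
    (hrate : r₁ + 2 * κ₀ + 2 ≤ R) (hsmall : A * Real.exp (b + 1) * K₀ * ν * c₁ ≤ 1) (hX : X.Nonempty)
    (hrep : ∀ s ∈ ball (0 : ℂ) μ₁, ∀ Z,
      act s Z = ∑ j ∈ terms Z, ∫ ω, pre j ω * cexp (lin j ω (V₀ + s • O)) ∂(ν' j))
    (hpre : ∀ j, AEStronglyMeasurable (pre j) (ν' j))
    (hlinw : ∀ j (Q : Pot), AEStronglyMeasurable (fun ω => lin j ω Q) (ν' j)) (hl : ∀ j ω, ‖lin j ω‖ ≤ l j ω)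
    (hint : ∀ j, Integrable (fun ω => ‖pre j ω‖ * Real.exp (l j ω * (ε₁ + μ₁ * b₀))) (ν' j))
    (hV₀ : ‖V₀‖ ≤ ε₁) (hO : ‖O‖ ≤ b₀) (hb₀ : 0 < b₀)
    (hL3 : ∀ Z, cubes Z ⊆ X →
      ∑ j ∈ terms Z, ∫ ω, ‖pre j ω‖ * Real.exp (l j ω * (ε₁ + μ₁ * b₀)) ∂(ν' j) ≤ A * Real.exp (-(R * d Z)))
    (h0 : 0 < μ₀) (h01 : μ₀ < μ₁) (hμ : ‖μ‖ ≤ μ₀) :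
    ‖locE ι cubes (act μ) X - locE ι cubes (act 0) X‖ ≤
      Real.exp 1 * ν * c₁ * K₀ ^ 2 * A * Real.exp (-(r₁ * dX)) * (μ₀ / (μ₁ - μ₀)) :=
  muPart_locE_le_of_rep ι (V := fun s => V₀ + s • O) hloc hreach hd hA hK₀ hc₁ hν hκ₀ hr₁ hc hb h126 hvol h227 hrate
    hsmall hX hrep hpre hlinw hl hint (differentiable_dressedTable_smul V₀ O).differentiableOn
    (mapsTo_dressedTable_smul hV₀ hO hb₀) hL3 h0 h01 hμ

end EndOfShape

/-! ## §5 NON-VACUITY of the analytic data of §1–§3 and §5 (a decided one-term toy; the B13 geometry binders of §4–§6 are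
the tree's `B13Resummation` shapes, untouched here) -/

section Toy

/-- The (2.14)-shape data of §1 are jointly inhabited [folklore]: one term, Dirac parameter measure, prefactor `1`, the
identity functional on the table space `ℂ` (norm `≤ 1`), the linearly dressed table `V₀ + s•O` on the source disc — the term
is complex differentiable in the source on the disc (by `differentiableOn_term_comp`, not by hand). -/
example (V₀ O : ℂ) {ε₁ μ₁ b : ℝ} (hV₀ : ‖V₀‖ ≤ ε₁) (hO : ‖O‖ ≤ b) (hb : 0 < b) :
    DifferentiableOn ℂ
      (fun s : ℂ => ∫ ω, (fun _ : Unit => (1 : ℂ)) ω *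
        cexp ((fun _ : Unit => ContinuousLinearMap.id ℂ ℂ) ω (V₀ + s • O)) ∂(Measure.dirac ()))
      (ball (0 : ℂ) μ₁) :=
  differentiableOn_term_comp (l := fun _ => 1) (R₀ := ε₁ + μ₁ * b) aestronglyMeasurable_const
    (fun _ => aestronglyMeasurable_const) (fun _ => ContinuousLinearMap.norm_id_le) (integrable_const _) isOpen_ball
    (differentiable_dressedTable_smul V₀ O).differentiableOn (mapsTo_dressedTable_smul hV₀ hO hb)

/-- … and its source-free majorant is the number `e^{ε₁ + μ₁ b}` (by `norm_term_comp_le`; the Dirac mass of `‖1‖·e^{R₀}`).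
[folklore] -/
example (V₀ O : ℂ) {ε₁ μ₁ b : ℝ} (hV₀ : ‖V₀‖ ≤ ε₁) (hO : ‖O‖ ≤ b) (hb : 0 < b) {s : ℂ} (hs : s ∈ ball (0 : ℂ) μ₁) :
    ‖∫ ω, (fun _ : Unit => (1 : ℂ)) ω *
        cexp ((fun _ : Unit => ContinuousLinearMap.id ℂ ℂ) ω (V₀ + s • O)) ∂(Measure.dirac ())‖ ≤
      Real.exp (ε₁ + μ₁ * b) := by
  have h := norm_term_comp_le (ν := Measure.dirac ()) (pre := fun _ : Unit => (1 : ℂ))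
    (lin := fun _ : Unit => ContinuousLinearMap.id ℂ ℂ) (l := fun _ => 1) (R₀ := ε₁ + μ₁ * b)
    (fun _ => ContinuousLinearMap.norm_id_le) (integrable_const _) (mapsTo_dressedTable_smul hV₀ hO hb) hs
  simpa using h

end Toy

end Summit.QuantumFields.BalabanUV.T4Continuum.NE1p.DressedSmallFieldShape

end
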